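import Literature.AlgebraicGeometry.HodgeTheory.UnitaryCommutatorsIdentityComponent
import Literature.AlgebraicGeometry.HodgeTheory.StabilizerRestrictionHom
import Literature.AlgebraicGeometry.HodgeTheory.HermitianFormEigenspaceNondegenerate
import Literature.AlgebraicGeometry.HodgeTheory.CyclicReflectionNormalizedRoot
import Literature.AlgebraicGeometry.HodgeTheory.CyclicReflectionEigenspaceSpan
import Literature.AlgebraicGeometry.HodgeTheory.ComplexReflectionTwist
import Literature.AlgebraicGeometry.HodgeTheory.ComplexReflectionRootScaling
import Literature.AlgebraicGeometry.HodgeTheory.CyclicEigenspaceDimensions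
import Literature.AlgebraicGeometry.HodgeTheory.CyclicReflectionRational
import Literature.AlgebraicGeometry.HodgeTheory.GlZariskiClosurePolynomialMap
import Literature.AlgebraicGeometry.HodgeTheory.ZariskiClosureBaseChange
import Literature.AlgebraicGeometry.HodgeTheory.CyclicEigenblockSection
import Summits.HodgeConjecture.HodgeConjecture.Theorems.CyclicUnitaryPowersLaneDKatz
import HarnessLib

/-!
# Crux K1 `VeryGeneralDeckCommutatorsInHg` (route `CyclicUnitaryPowers`, stmt-HodgeConjecture-19544), line
# `unitary-reflection-zariski` v9, lane D: the GLUE `stub_unitaryCommutatorsInMon_of_facts : CT71 → GKR' → UD → D`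
# LANDED as a theorem (Carlson–Toledo 1999 Theorem 7.1 route; Katz 1990 Prop. 1.8.2)

The registered skeleton v9 (`Cruxes/VeryGeneralDeckCommutatorsInHg/Lines/unitary-reflection-zariski`, planner P3
g23) re-typed the lane-D binder as `stub_unitaryCommutatorsInMon_of_facts :
carlsonToledo1999_unitaryReflection_zariskiDense → Katz1990_goursatKolchinRibet_specialLinear' →
specialLinear_subset_glIdentityComponent_of_unitary_commutators → D`.  This file proves it (statement verbatim),
so the composition `VeryGeneralDeckCommutatorsInHg_of` of the line closes the crux modulo the two cited facts CT71
and GKR' (UD is a theorem: `CyclicUnitaryPowersUnitaryDense.stub_unitaryDense`).  Proof architecture and all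
per-place / twist / descent lemmas: prover seat `hodge-nonav-prover-Ax` (g0) — `ZariskiClosureBaseChange`,
`GlZariskiClosureGroup`, `UnitaryReflectionCommutatorsZariski`, `CyclicReflection*`, `ComplexReflectionTwist`,
`StabilizerRestrictionHom`, `GlZariskiClosurePolynomialMap`; eigenspace dimensions and the block section: prover
seat `hodge-nonav-prover-A` (g2) — `CyclicEigenspaceDimensions`, `PerfectPairingTranspose`, `EigenblockSection`,
`CyclicEigenblockSection`; the facts: typist `hodge-nonav-littype` (`GoursatKolchinRibetCriterion`,
`UnitaryReflectionGroupZariskiDense`).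

## References
* [CarlsonToledo1999] J. A. Carlson, D. Toledo, *Discriminant complements and kernels of monodromy
  representations*, Duke Math. J. 97 (1999), §§2, 5, 6, 7 (Theorem 7.1).
* [Katz1990ESDE] N. M. Katz, *Exponential Sums and Differential Equations*, Ann. of Math. Stud. 124 (1990),
  §1.8 Prop. 1.8.2.
-/

noncomputable section

open Module Literature.AlgebraicGeometry.Motives Literature.AlgebraicGeometry.HodgeTheory
open scoped TensorProduct ComplexConjugate

-- `Summit.HodgeConjecture.HodgeConjecture.Theorems` is the mandated namespace (single-problem summit), which
-- `linter.dupNamespace` flags; the lakefile turns the linter off tree-wide, restated here for stand-alone checks.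
set_option linter.dupNamespace false

namespace Summit.HodgeConjecture.HodgeConjecture.Theorems.CyclicUnitaryPowersLaneDGlue

/-- **The lane-D glue `stub_unitaryCommutatorsInMon_of_facts` of line `unitary-reflection-zariski` (v9) of crux K1
`VeryGeneralDeckCommutatorsInHg`, PROVED**: from Carlson–Toledo's density theorem (CT71, per eigenspace), Katz's
Goursat–Kolchin–Ribet criterion (GKR') and the unitary-density fact (UD, itself a theorem:
`specialLinear_subset_glIdentityComponent_of_unitary_commutators_holds`), the commutator `g h g⁻¹ h⁻¹` of two
`τ`-commuting `B`-isometries lies in the identity component `(Γ^Zar)°` of the Zariski closure of the monodromy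
group `Γ` generated by the cyclic reflections (`dim V^τ ≤ 1`, `p ≥ 7` prime). Assembly (prover-Ax g0): descent to
`Γ ⊗ ℂ`; the places `E_i = H(ζ^{i+1})`, `i < (p−1)/2`, stabilised by `Γ ⊗ ℂ`; low dimension ⇒ the commutator is
trivial (`CyclicEigenspaceDimensions`); per place the Carlson–Toledo data (orbit of a normalised root, reflections,
closure equality) ⇒ unitary commutators in the closure (`UnitaryReflectionCommutatorsZariski`); no twists between
places (`ComplexReflectionTwist`) ⇒ Katz ⇒ `⊕ SL(E_i)` in the identity component of the block image; the block
SECTION (`CyclicEigenblockSection`, prover-A g2) transports this back to `V ⊗ ℂ`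
(`mem_glIdentityComponent_of_evalAtInvDet_of_leftInverse`). [cite: CarlsonToledo1999, §7 Theorem 7.1 (p. 16)]
[cite: Katz1990ESDE, §1.8 Prop. 1.8.2] -/
theorem stub_unitaryCommutatorsInMon_of_facts : Literature.AlgebraicGeometry.HodgeTheory.carlsonToledo1999_unitaryReflection_zariskiDense → Literature.AlgebraicGeometry.HodgeTheory.Katz1990_goursatKolchinRibet_specialLinear' → Literature.AlgebraicGeometry.HodgeTheory.specialLinear_subset_glIdentityComponent_of_unitary_commutators → open Literature.AlgebraicGeometry.Motives Literature.AlgebraicGeometry.HodgeTheory Literature.AlgebraicGeometry.HodgeTheory.BettiUniverse CategoryTheory.Limits in ∀ (V : Type) [AddCommGroup V] [Module ℚ V] [Module.Finite ℚ V] (B : LinearMap.BilinForm ℚ V) (τ : V ≃ₗ[ℚ] V) (p : ℕ) (R : Set V) (Γ : Subgroup (V ≃ₗ[ℚ] V)), p.Prime → 7 ≤ p → B.IsSymm → B.Nondegenerate → τ ^ p = 1 → (∀ x y, B (τ x) (τ y) = B x y) → Module.finrank ℚ ↥(Module.End.eigenspace (τ : V →ₗ[ℚ] V) 1) ≤ 1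 → (∀ δ ∈ R, δ ≠ 0 ∧ (∑ i ∈ Finset.range p, (τ ^ i) δ) = 0 ∧ ∀ x ∈ Submodule.span ℚ (Set.range fun i : ℕ => (τ ^ i) δ), (∀ y ∈ Submodule.span ℚ (Set.range fun i : ℕ => (τ ^ i) δ), B x y = 0) → x = 0) → (∀ δ ∈ R, ∃ r ∈ Γ, ((∀ x ∈ Submodule.span ℚ (Set.range fun i : ℕ => (τ ^ i) δ), r x = τ x) ∧ (∀ x, (∀ y ∈ Submodule.span ℚ (Set.range fun i : ℕ => (τ ^ i) δ), B x y = 0) → r x = x))) → (Γ ≤ Subgroup.closure {r : V ≃ₗ[ℚ] V | ∃ δ ∈ R, ((∀ x ∈ Submodule.span ℚ (Set.range fun i : ℕ => (τ ^ i) δ), r x = τ x) ∧ (∀ x, (∀ y ∈ Submodule.span ℚ (Set.range fun i : ℕ => (τ ^ i) δ), B x y = 0) → r x = x))}) → (∀ δ ∈ R, ∀ δ' ∈ R, ∃ γ ∈ Γ, γ δ' ∈ Submodule.span ℚ (Set.range fun i : ℕ => (τ ^ i) δ)) → (∀ x, (∑ i ∈ Finset.range p, (τ ^ i) x) = 0 →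 x ∈ Submodule.span ℚ {y | ∃ δ ∈ R, ∃ i : ℕ, y = (τ ^ i) δ}) → ∀ g h : V ≃ₗ[ℚ] V, (∀ x, g (τ x) = τ (g x)) → (∀ x y, B (g x) (g y) = B x y) → (∀ x, h (τ x) = τ (h x)) → (∀ x y, B (h x) (h y) = B x y) → g * h * g⁻¹ * h⁻¹ ∈ glIdentityComponent Γ := by
  intro hCT hK hU V _ _ _ B τ p R Γ hp h7 hBs hBn hτp hτB hfix hP1 hP2 hP3 hP4 hP5 g h hgτ hgB hhτ hhB
  have hp0 : 0 < p := hp.pos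
  -- (0) the generators, hence Γ, commute with τ and preserve B  [6a: cyclicReflection_comm / _isometry,
  --     comm_and_isometry_of_mem_closure]
  have hpow : ∀ n : ℕ, ((τ : V →ₗ[ℚ] V)) ^ n = ((τ ^ n : V ≃ₗ[ℚ] V) : V →ₗ[ℚ] V) := by
    intro n
    induction n with
    | zero => rw [pow_zero, pow_zero, LinearEquiv.coe_toLinearMap_one]; rfl
    | succ n ih => rw [pow_succ, pow_succ, LinearEquiv.coe_toLinearMap_mul, ih]
  have hτp' : ((τ : V →ₗ[ℚ] V)) ^ p = 1 := by
    rw [hpow, hτp, LinearEquiv.coe_toLinearMap_one]; rfl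
  -- `(↑τ ^ i) δ = (τ ^ i) δ` as functions, to transport the clauses of D to linear maps
  have hpowapp : ∀ (i : ℕ) (x : V), (((τ : V →ₗ[ℚ] V)) ^ i) x = (τ ^ i) x := fun i x => by
    rw [hpow]; rfl
  have hgen : ∀ s ∈ {r : V ≃ₗ[ℚ] V | ∃ δ ∈ R, ((∀ x ∈ Submodule.span ℚ (Set.range fun i : ℕ => (τ ^ i) δ), r x = τ x) ∧
      (∀ x, (∀ y ∈ Submodule.span ℚ (Set.range fun i : ℕ => (τ ^ i) δ), B x y = 0) → r x = x))},
      (∀ x, s (τ x) = τ (s x)) ∧ ∀ x y, B (s x) (s y) = B x y := by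
    rintro s ⟨δ, hδ, hs1, hs2⟩
    have hnd := (hP1 δ hδ).2.2
    have hs1' : ∀ x ∈ Submodule.span ℚ (Set.range fun i : ℕ => ((τ : V →ₗ[ℚ] V) ^ i) δ),
        (s : V →ₗ[ℚ] V) x = (τ : V →ₗ[ℚ] V) x := by
      simpa only [hpowapp, LinearEquiv.coe_coe] using hs1
    have hs2' : ∀ x, (∀ y ∈ Submodule.span ℚ (Set.range fun i : ℕ => ((τ : V →ₗ[ℚ] V) ^ i) δ), B x y = 0) →
        (s : V →ₗ[ℚ] V) x = x := by
      simpa only [hpowapp, LinearEquiv.coe_coe] using hs2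
    have hnd' : ∀ x ∈ Submodule.span ℚ (Set.range fun i : ℕ => ((τ : V →ₗ[ℚ] V) ^ i) δ),
        (∀ y ∈ Submodule.span ℚ (Set.range fun i : ℕ => ((τ : V →ₗ[ℚ] V) ^ i) δ), B x y = 0) → x = 0 := by
      simpa only [hpowapp] using hnd
    refine ⟨fun x => ?_, fun x y => ?_⟩
    · exact cyclicReflection_comm (r := (s : V →ₗ[ℚ] V)) hBs hp0 hτp' hτB hnd' hs1' hs2' x
    · exact cyclicReflection_isometry (r := (s : V →ₗ[ℚ] V)) hBs hτB hnd' hs1' hs2' x y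
  have hΓτB : ∀ γ ∈ Γ, (∀ x, γ (τ x) = τ (γ x)) ∧ ∀ x y, B (γ x) (γ y) = B x y :=
    fun γ hγ => comm_and_isometry_of_mem_closure B τ hgen (hP3 hγ)
  -- (1) a primitive p-th root of unity
  have hζ := Complex.isPrimitiveRoot_exp p hp.ne_zero
  set ζ : ℂ := Complex.exp (2 * Real.pi * Complex.I / p) with hζdef
  -- (2) descent to ℚ: it suffices to put the complexified commutator in the identity component of Γ ⊗ ℂ
  refine mem_glIdentityComponent_of_baseChange (K := ℚ) (L := ℂ) ?_
  set Γc : Subgroup (ℂ ⊗[ℚ] V ≃ₗ[ℂ] ℂ ⊗[ℚ] V) := Γ.map (glBaseChangeHom ℚ ℂ V) with hΓc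
  -- (3) the places E_i = H(ζ^(i+1)), i < (p-1)/2, stabilised by Γ ⊗ ℂ; H := image of Γ ⊗ ℂ in Π GL(E_i)
  set k : ℕ := (p - 1) / 2 with hk
  let E : Fin k → Submodule ℂ (ℂ ⊗[ℚ] V) :=
    fun i => Module.End.eigenspace ((τ : V →ₗ[ℚ] V).baseChange ℂ) (ζ ^ ((i : ℕ) + 1))
  have hstabE : ∀ i, Γc ≤ submoduleStabilizer (E i) := fun i =>
    map_glBaseChangeHom_le_submoduleStabilizer_eigenspace (fun γ hγ => (hΓτB γ hγ).1) _
  let ρ : Γc →* Π i, (E i ≃ₗ[ℂ] E i) := piRestrictHom E Γc hstabE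
  let ψ : Γc →* ((Π i, E i) ≃ₗ[ℂ] (Π i, E i)) := (blockDiagHom fun i => ↥(E i)).comp ρ
  set H : Subgroup (Π i, (E i ≃ₗ[ℂ] E i)) := (⊤ : Subgroup Γc).map ρ with hH
  -- (4) dimensions: all E_i have the same dimension b [TODO lemma finrank_eigenspace_eq_of_galois];
  --     if b ≤ 1 the commutator is trivial [TODO]; assume 2 ≤ b below
  by_cases hdim : ∀ i : Fin k, 2 ≤ finrank ℂ (E i)
  swap
  · -- S2 (low dimension): some `H(ζ^(i₀+1))` has dimension ≤ 1; then ALL `H(ζ^a)`, `a ≠ 0`, do (Galois /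
    --   traces: `CyclicEigenspaceDimensions`, prover-A) and `dim H(1) ≤ 1` (clause hfix), so `g` and `h` commute
    --   and the commutator is trivial [`commutator_eq_one_of_finrank_eigenspace_le_one`]
    simp only [not_forall, not_le] at hdim
    obtain ⟨i₀, hi₀⟩ := hdim
    have hsmall : finrank ℂ (Module.End.eigenspace ((τ : V →ₗ[ℚ] V).baseChange ℂ) (ζ ^ ((i₀ : ℕ) + 1))) ≤ 1 := by
      have : finrank ℂ (E i₀) < 2 := hi₀
      exact Nat.le_of_lt_succ this
    have h1 : g * h * g⁻¹ * h⁻¹ = 1 :=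
      commutator_eq_one_of_finrank_eigenspace_le_one hp hτp' hζ hfix (show 1 ≤ (i₀ : ℕ) + 1 by omega)
        (by have := i₀.2; omega) hsmall hgτ hhτ
    rw [h1, map_one]
    exact one_mem_glIdentityComponent _
  -- (4b) transported clauses, indices, non-emptiness of R, and the per-place reflection data
  have hP1' : ∀ δ ∈ R, δ ≠ 0 ∧ (∑ i ∈ Finset.range p, (((τ : V →ₗ[ℚ] V)) ^ i) δ) = 0 ∧
      ∀ x ∈ Submodule.span ℚ (Set.range fun i : ℕ => (((τ : V →ₗ[ℚ] V)) ^ i) δ),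
        (∀ y ∈ Submodule.span ℚ (Set.range fun i : ℕ => (((τ : V →ₗ[ℚ] V)) ^ i) δ), B x y = 0) → x = 0 := by
    intro δ hδ
    simpa only [hpowapp] using hP1 δ hδ
  have hik : ∀ i : Fin k, 1 ≤ (i : ℕ) + 1 ∧ (i : ℕ) + 1 < p := fun i => ⟨by omega, by have := i.2; omega⟩
  -- (5) Goursat–Kolchin–Ribet on the half system of blocks [`CyclicUnitaryPowersLaneDKatz`, prover-Ax's per-place
  --     Carlson–Toledo data + twist dichotomies]: `⊕ SL(E_i) ⊆ glIdentityComponent (H.map blockDiagHom)`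
  have hKatz := CyclicUnitaryPowersLaneDKatz.blockDiag_mem_glIdentityComponent hCT hK hU V B τ p R Γ hp h7 hBs hBn
    hτp hτB hP1 hP2 hP3 hP4 hP5 hΓτB hζ k hk hstabE hdim
  have hodd : p % 2 = 1 := Nat.odd_iff.mp (hp.odd_of_ne_two (by omega))
  have hΓfix : ∀ γ ∈ Γ, ∀ v, (τ : V →ₗ[ℚ] V) v = v → γ v = v := by
    intro γ hγ v hv
    refine apply_eq_self_of_mem_closure (fun s hs => ?_) (hP3 hγ)
    obtain ⟨δ, hδ, hs1, hs2⟩ := hs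
    have hs2' : ∀ x, (∀ y ∈ Submodule.span ℚ (Set.range fun i : ℕ => ((τ : V →ₗ[ℚ] V) ^ i) δ), B x y = 0) →
        (s : V →ₗ[ℚ] V) x = x := by
      simpa only [hpowapp, LinearEquiv.coe_coe] using hs2
    exact cyclicReflection_apply_of_apply_eq_self (r := (s : V →ₗ[ℚ] V)) hp0 hτB (hP1' δ hδ).2.1 hs2' hv
  obtain ⟨b, c, P, u, hPsec, hu, hPc⟩ := exists_cyclicEigenblockSection_pointwise hBs hBn hp0 hτp' hτB hζ
    (fun i : Fin k => (i : ℕ) + 1) (fun i => hik i) (fun i j hij => Fin.ext (by simpa using hij))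
    (fun i j => by have := i.2; have := j.2; omega)
    (fun m hm1 hmp => by
      by_cases hmk : m ≤ k
      · exact ⟨⟨m - 1, by omega⟩, Or.inl (show m - 1 + 1 = m by omega)⟩
      · exact ⟨⟨p - m - 1, by omega⟩, Or.inr (show p - m - 1 + 1 + m = p by omega)⟩)
    E (fun _ => rfl) (fun γ hγ => (hΓτB γ hγ).1) (fun γ hγ => (hΓτB γ hγ).2) hΓfix hstabE hfix hgτ hgB hhτ hhB
  refine mem_glIdentityComponent_of_evalAtInvDet_of_leftInverse b c P Γc ψ hPsec ?_ hPc
  -- Katz's conclusion, with H.map blockDiagHom = ⊤.map ψ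
  have hHψ : H.map (blockDiagHom fun i => ↥(E i)) = (⊤ : Subgroup Γc).map ψ := by
    rw [hH, Subgroup.map_map]
  rw [← hHψ]
  exact hKatz u hu

end Summit.HodgeConjecture.HodgeConjecture.Theorems.CyclicUnitaryPowersLaneDGlue

end
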